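import Mathlib.RingTheory.PowerSeries.Substitution
import Mathlib.RingTheory.PowerSeries.Expand
import Mathlib.RingTheory.PowerSeries.Trunc
import Mathlib.NumberTheory.Padics.PadicIntegers
import Mathlib.NumberTheory.Padics.RingHoms
import Mathlib.Analysis.Normed.Group.Ultra
import Mathlib.Algebra.CharP.Frobenius
import Mathlib.Algebra.Ring.GeomSum
import Mathlib.Data.Nat.Choose.Dvd
import Mathlib.FieldTheory.Finite.Basic
import Literature.RingTheory.FormalGroups.DworkFrobeniusLift
import HarnessLib

/-!
# Honda's two-term functional equation `ℓ − (a/p)ℓ(Xᵖ) + (1/p)ℓ(X^{p²}) ∈ ℤ_p⟦X⟧`: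
# transport along integral substitutions (Hazewinkel's functional equation lemma, (iii)–(iv))

Topic `RingTheory/FormalGroups` (theorems, plus three auxiliary *data* definitions; no named
facts). For a prime `p`, `a ∈ ℤ_p` and `ℓ ∈ ℚ_p⟦X⟧` put

  `hondaShift p a ℓ = ℓ − (a/p)·ℓ(Xᵖ) + (1/p)·ℓ(X^{p²})`.

"`ℓ` is of (Honda) type `u = p − aT + T²`" means that `hondaShift p a ℓ` has `p`-integral
coefficients: Honda 1970, §2.1, Definition (p. 221: `f` is of type `(P; u)` iff `f ≡ Px mod deg 2`
and `(u∗f)(x) ≡ 0 mod 𝔭`, where `(Σ C_ν T^ν) ∗ f = Σ C_ν f^{σ^ν}(x^{q^ν})`), here with `𝔬 = ℤ_p`,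
`σ = id`, `u = p − aT + T²` divided by `p`; equivalently Hazewinkel 1978, Ch. I §2.1–2.2 with
`s₁ = a/p`, `s₂ = −1/p`, `sᵢ = 0` (`i ≥ 3`): `ℓ = f_g` for `g = hondaShift p a ℓ`. The example to
keep in mind (Honda 1970, §6, (6.2) and Thm. 8, p. 239; §6.2, pp. 240–242) is the logarithm
`Σ aₙ Xⁿ/n` of a Dirichlet series with Euler factor `(1 − a_p p⁻ˢ + p^{1−2s})⁻¹` at `p` — a
weight-two Hecke eigenform (`a_{pn} = a_p aₙ − p a_{n/p}`), or an elliptic curve at a good prime.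

Main results (all over `ℚ_p`, integrality spelled `‖·‖ ≤ 1` coefficientwise):

* `norm_coeff_hondaShift_mk_div_le_one` — **the Hecke recursion gives the type**: if `a₀ = 0`,
  `‖aₙ‖ ≤ 1` and `a_{pn} = a_p aₙ − p·a_{n/p}` for `n ≥ 1`, then `Σ aₙXⁿ/n` is of type
  `p − a_pT + T²`; in fact `hondaShift` kills exactly the coefficients at the multiples of `p`
  (`coeff_hondaShift_mk_div`). [Honda 1970, Thm. 8 with (6.2), p. 239]
* `norm_coeff_subst_sub_subst_le` — **functional equation lemma (iv)**: if `ℓ` is of type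
  `p − aT + T²` and `α ≡ β (mod pʳ)`, `r ≥ 1`, are integral without constant term, then
  `ℓ(α) ≡ ℓ(β) (mod pʳ)`. [Hazewinkel 1978, I.2.2 (iv); Honda 1970, Lemma 2.1 and the proof of
  Lemma 2.3, p. 222]
* `norm_coeff_hondaShift_subst_le_one` — **Honda's Lemma 2.3 / functional equation lemma (iii),
  the transport theorem**: if `ℓ` is of type `p − aT + T²` and `θ ∈ Xℤ_p⟦X⟧`, then `ℓ ∘ θ` is
  again of type `p − aT + T²` ("if `ψ ∈ 𝔬⟦x′⟧₀` … `u∗(f∘ψ) ≡ (u∗f)∘ψ mod 𝔭`", Honda 1970,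
  Lemma 2.3, p. 222). [Hazewinkel 1978, I.2.2 (iii)]
* `norm_coeff_substInvOfIsUnit_le_one` — the compositional inverse of `θ = X + ⋯ ∈ ℤ_p⟦X⟧` is
  integral.
* `dvd_sub_of_hondaShift` — **reading off `a (mod p)`**: if `ℓ = X + ⋯` is of type
  `p − aT + T²` and `p·[Xᵖ]ℓ = c ∈ ℤ`, `a ∈ ℤ`, then `p ∣ c − a`.

Together: if `u = Σ aₙqⁿ/n` (Hecke type `p − a_pT + T²`) equals `log_E(z(q))` for an integral
`z(q) = q + ⋯`, then `log_E = u ∘ z⁻¹` is of type `p − a_pT + T²`, so `c_{p-1}(ω_E) ≡ a_p (mod p)`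
— the use made of this file in `NumberTheory/EllipticCurves`: the Eichler–Shimura congruence for
`ℂ/Λ_f` via formal groups, along the lines of Honda 1970, §6.2 (pp. 241–242: "our results yield
a simple proof of a special case of the main result of Eichler [6] and Shimura [18]", carried out
there for `X₀(N)` of genus one with the parameter `j(z)⁻¹`, `g = f∘φ`, (6.9)).

## The argument

(iv): iterating the definition, `ℓ = Σ_{k≤K} b_k g(X^{p^k}) + b_{K+1} ℓ(X^{p^{K+1}}) −
(b_K/p) ℓ(X^{p^{K+2}})` with `b₀ = 1`, `b₁ = a/p`, `b_{k+2} = (a/p)b_{k+1} − (1/p)b_k`, so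
`‖b_k‖ ≤ pᵏ` (`hondaShift_iterate`, `norm_hondaB_le`); substituting `α`, `β` and comparing the
coefficient of `Xⁿ` for `K = n` (the two tail terms do not contribute below degree `p^{n+1} > n`),
`α^{p^k} ≡ β^{p^k} (mod p^{r+k})` (`norm_coeff_pow_prime_pow_sub_le`, binomial theorem, needs
`r ≥ 1`) and `g ∈ ℤ_p⟦X⟧` give `‖[Xⁿ](ℓ(α) − ℓ(β))‖ ≤ max_k pᵏ·p^{-(r+k)} = p^{-r}`.
(iii): `hondaShift(ℓ∘θ) = g∘θ + (a/p)(ℓ(θᵖ) − ℓ(θ(Xᵖ))) − (1/p)(ℓ(θ^{p²}) − ℓ(θ(X^{p²})))`, and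
`θᵖ ≡ θ(Xᵖ)`, `θ^{p²} ≡ θ(X^{p²}) (mod p)` (Frobenius on `𝔽_p⟦X⟧`,
`norm_coeff_pow_sub_expand_le`), so (iv) with `r = 1` bounds both brackets by `p⁻¹`.

## Sources

* T. Honda, *On the theory of commutative formal groups*, J. Math. Soc. Japan 22 (1970), 213–246
  (held: `paper:doi-10-2969-jmsj-02220213`, read): §2.1 Definition of the type `(P; u)` and
  Lemmas 2.1–2.2 (p. 221), Lemmas 2.3–2.4 (p. 222), Thm. 2 (p. 223); §6.1 (6.1)–(6.2), Thm. 8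
  (p. 239), Cor. 2; §6.2 Thm. 9 and the modular example (6.8)–(6.9) (pp. 240–242). [Honda1970]
* M. Hazewinkel, *Formal Groups and Applications*, Academic Press 1978, Ch. I, §2.1 (the
  functional-equation series `f_g`), §2.2 "The functional equation lemma", parts (iii), (iv), and
  §2.3 (proofs). [Hazewinkel1978]
* T. Honda, *Formal groups and zeta-functions*, Osaka J. Math. 5 (1968), 199–213 (Honda's [10]:
  the case of elliptic curves over `ℚ`).

## Design notes

Pure `PowerSeries.subst` / `PowerSeries.expand` algebra over `ℚ_p`; congruences modulo `pʳ` are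
spelled `‖coeff n (·)‖ ≤ p^{-r}` (ultrametric bookkeeping, no quotient rings), except for the one
Frobenius computation, done in `𝔽_p⟦X⟧` through `ℤ_p → ℤ/p`. The three definitions
(`hondaShift`, `hondaB`, `liftInt`) are data; nothing is asserted.
-/

noncomputable section

open PowerSeries

namespace Literature.RingTheory.FormalGroups

variable {p : ℕ} [hp : Fact p.Prime]

/-! ### Coefficientwise norm bounds in `ℚ_p⟦X⟧` -/

section Bounds

/-- `‖[Xⁿ]1‖ ≤ 1`. [folklore] -/
theorem norm_coeff_one_le (n : ℕ) : ‖coeff n (1 : ℚ_[p]⟦X⟧)‖ ≤ 1 := by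
  rw [coeff_one]
  split_ifs <;> simp

/-- `‖[Xⁿ](C c · f)‖ = ‖c‖·‖[Xⁿ]f‖`. [folklore] -/
theorem norm_coeff_C_mul (c : ℚ_[p]) (f : ℚ_[p]⟦X⟧) (n : ℕ) :
    ‖coeff n (C c * f)‖ = ‖c‖ * ‖coeff n f‖ := by
  rw [coeff_C_mul, norm_mul]

/-- Ultrametric bound for a sum of two series. [folklore] -/
theorem norm_coeff_add_le {f g : ℚ_[p]⟦X⟧} {A : ℝ} (hf : ∀ n, ‖coeff n f‖ ≤ A)
    (hg : ∀ n, ‖coeff n g‖ ≤ A) (n : ℕ) : ‖coeff n (f + g)‖ ≤ A := by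
  rw [map_add]
  exact (IsUltrametricDist.norm_add_le_max _ _).trans (max_le (hf n) (hg n))

/-- Ultrametric bound for a difference of two series. [folklore] -/
theorem norm_coeff_sub_le {f g : ℚ_[p]⟦X⟧} {A : ℝ} (hf : ∀ n, ‖coeff n f‖ ≤ A)
    (hg : ∀ n, ‖coeff n g‖ ≤ A) (n : ℕ) : ‖coeff n (f - g)‖ ≤ A := by
  rw [sub_eq_add_neg]
  refine norm_coeff_add_le hf (fun m ↦ ?_) n
  rw [map_neg, norm_neg]; exact hg m

/-- Ultrametric bound for a finite sum of series. [folklore] -/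
theorem norm_coeff_sum_le {ι : Type*} (s : Finset ι) (F : ι → ℚ_[p]⟦X⟧) {A : ℝ} (hA : 0 ≤ A)
    (hF : ∀ i ∈ s, ∀ n, ‖coeff n (F i)‖ ≤ A) (n : ℕ) : ‖coeff n (∑ i ∈ s, F i)‖ ≤ A := by
  rw [map_sum]
  exact IsUltrametricDist.norm_sum_le_of_forall_le_of_nonneg hA fun i hi ↦ hF i hi n

/-- **Gauss-norm submultiplicativity**: if all coefficients of `f` have norm `≤ A` and those of
`g` have norm `≤ B`, then those of `f·g` have norm `≤ A·B`. [folklore] -/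
theorem norm_coeff_mul_le {f g : ℚ_[p]⟦X⟧} {A B : ℝ} (hA : 0 ≤ A) (hB : 0 ≤ B)
    (hf : ∀ n, ‖coeff n f‖ ≤ A) (hg : ∀ n, ‖coeff n g‖ ≤ B) (n : ℕ) :
    ‖coeff n (f * g)‖ ≤ A * B := by
  rw [coeff_mul]
  refine IsUltrametricDist.norm_sum_le_of_forall_le_of_nonneg (mul_nonneg hA hB) fun ij _ ↦ ?_
  rw [norm_mul]
  exact mul_le_mul (hf _) (hg _) (norm_nonneg _) hA

/-- Coefficients of a power of a series with coefficients of norm `≤ A`. [folklore] -/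
theorem norm_coeff_pow_le {f : ℚ_[p]⟦X⟧} {A : ℝ} (hA : 0 ≤ A) (hf : ∀ n, ‖coeff n f‖ ≤ A)
    (k n : ℕ) : ‖coeff n (f ^ k)‖ ≤ A ^ k := by
  induction k generalizing n with
  | zero => rw [pow_zero, pow_zero]; exact norm_coeff_one_le n
  | succ k ih =>
    rw [pow_succ, pow_succ]
    exact norm_coeff_mul_le (pow_nonneg hA k) hA ih hf n

/-- Powers of an integral series are integral. [folklore] -/
theorem norm_coeff_pow_le_one {f : ℚ_[p]⟦X⟧} (hf : ∀ n, ‖coeff n f‖ ≤ 1) (k n : ℕ) :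
    ‖coeff n (f ^ k)‖ ≤ 1 := by
  simpa using norm_coeff_pow_le zero_le_one hf k n

/-- A product of an integral series and a series with coefficients of norm `≤ B`. [folklore] -/
theorem norm_coeff_mul_le_of_le_one {f g : ℚ_[p]⟦X⟧} {B : ℝ} (hB : 0 ≤ B)
    (hf : ∀ n, ‖coeff n f‖ ≤ 1) (hg : ∀ n, ‖coeff n g‖ ≤ B) (n : ℕ) :
    ‖coeff n (f * g)‖ ≤ B := by
  simpa using norm_coeff_mul_le zero_le_one hB hf hg n

/-- `xᵏ − yᵏ = (x − y)·Σ xⁱ y^{k-1-i}` has coefficients bounded by those of `x − y` when `x, y`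
are integral. [folklore] -/
theorem norm_coeff_pow_sub_pow_le {x y : ℚ_[p]⟦X⟧} {ε : ℝ} (hε : 0 ≤ ε)
    (hx : ∀ n, ‖coeff n x‖ ≤ 1) (hy : ∀ n, ‖coeff n y‖ ≤ 1) (hxy : ∀ n, ‖coeff n (x - y)‖ ≤ ε)
    (k n : ℕ) : ‖coeff n (x ^ k - y ^ k)‖ ≤ ε := by
  rw [← (Commute.all x y).geom_sum₂_mul, mul_comm]
  refine norm_coeff_mul_le_of_le_one' hε hxy ?_ n
  intro m
  refine norm_coeff_sum_le _ _ zero_le_one (fun i _ m' ↦ ?_) m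
  simpa using norm_coeff_mul_le zero_le_one zero_le_one (norm_coeff_pow_le_one hx i)
    (norm_coeff_pow_le_one hy _) m'
where
  /-- (product bound with the roles of the factors exchanged) -/
  norm_coeff_mul_le_of_le_one' {f g : ℚ_[p]⟦X⟧} {B : ℝ} (hB : 0 ≤ B)
      (hf : ∀ n, ‖coeff n f‖ ≤ B) (hg : ∀ n, ‖coeff n g‖ ≤ 1) (n : ℕ) :
      ‖coeff n (f * g)‖ ≤ B := by
    simpa using norm_coeff_mul_le hB zero_le_one hf hg n

end Bounds

/-! ### Substitution: truncation formula, integrality, differences -/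

section Subst

/-- **Only the first `m + 1` coefficients of `g` matter for `[X^m] g(γ)`** (`γ(0) = 0`):
`[X^m] g(γ) = Σ_{i ≤ m} gᵢ · [X^m] γⁱ`. [folklore] -/
theorem coeff_subst_eq_sum {γ : ℚ_[p]⟦X⟧} (hγ : constantCoeff γ = 0) (g : ℚ_[p]⟦X⟧) (m : ℕ) :
    coeff m (g.subst γ) = ∑ i ∈ Finset.range (m + 1), coeff i g * coeff m (γ ^ i) := by
  have hs : HasSubst γ := HasSubst.of_constantCoeff_zero' hγ
  rw [coeff_subst' hs, finsum_eq_sum_of_support_subset _ (s := Finset.range (m + 1))]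
  · simp only [smul_eq_mul]
  · intro i hi
    rw [Function.mem_support] at hi
    rw [Finset.coe_range, Set.mem_Iio]
    by_contra h
    rw [not_lt] at h
    apply hi
    have hord : coeff m (γ ^ i) = 0 := by
      refine coeff_of_lt_order m ?_
      refine lt_of_lt_of_le ?_ (le_order_pow_of_constantCoeff_eq_zero i hγ)
      exact_mod_cast Nat.lt_of_lt_of_le (Nat.lt_succ_self m) h
    rw [hord, smul_zero]

/-- **Integral series are closed under substitution**: `g, θ ∈ ℤ_p⟦X⟧`, `θ(0) = 0` ⇒
`g(θ) ∈ ℤ_p⟦X⟧`. [folklore] -/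
theorem norm_coeff_subst_le_one {g θ : ℚ_[p]⟦X⟧} (hθ0 : constantCoeff θ = 0)
    (hg : ∀ n, ‖coeff n g‖ ≤ 1) (hθ : ∀ n, ‖coeff n θ‖ ≤ 1) (n : ℕ) :
    ‖coeff n (g.subst θ)‖ ≤ 1 := by
  rw [coeff_subst_eq_sum hθ0]
  refine IsUltrametricDist.norm_sum_le_of_forall_le_of_nonneg zero_le_one fun i _ ↦ ?_
  rw [norm_mul]
  simpa using mul_le_mul (hg i) (norm_coeff_pow_le_one hθ i n) (norm_nonneg _) zero_le_one

/-- **`g(γ) ≡ g(δ)` modulo whatever `γ ≡ δ` is**, for `g ∈ ℤ_p⟦X⟧` and integral `γ, δ` without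
constant term. [Hazewinkel 1978, I.2.3 (proof of (iv), the integral part)] [folklore] -/
theorem norm_coeff_subst_sub_subst_le_of_integral {g γ δ : ℚ_[p]⟦X⟧} {ε : ℝ} (hε : 0 ≤ ε)
    (hγ0 : constantCoeff γ = 0) (hδ0 : constantCoeff δ = 0) (hg : ∀ n, ‖coeff n g‖ ≤ 1)
    (hγ : ∀ n, ‖coeff n γ‖ ≤ 1) (hδ : ∀ n, ‖coeff n δ‖ ≤ 1) (hγδ : ∀ n, ‖coeff n (γ - δ)‖ ≤ ε)
    (n : ℕ) : ‖coeff n (g.subst γ - g.subst δ)‖ ≤ ε := by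
  rw [map_sub, coeff_subst_eq_sum hγ0, coeff_subst_eq_sum hδ0, ← Finset.sum_sub_distrib]
  refine IsUltrametricDist.norm_sum_le_of_forall_le_of_nonneg hε fun i _ ↦ ?_
  rw [← mul_sub, norm_mul, ← map_sub]
  simpa using mul_le_mul (hg i) (norm_coeff_pow_sub_pow_le hε hγ hδ hγδ i n) (norm_nonneg _)
    zero_le_one

/-- Below the order of `γ`, `[X^m] ℓ(γ)` does not depend on `γ`: if `X^{m+1} ∣ γ` then
`[X^m] ℓ(γ) = ℓ(0)·[X^m]1`. [folklore] -/
theorem coeff_subst_of_X_pow_dvd {γ : ℚ_[p]⟦X⟧} (ℓ : ℚ_[p]⟦X⟧) {m : ℕ} (hγ : X ^ (m + 1) ∣ γ) :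
    coeff m (ℓ.subst γ) = constantCoeff ℓ * coeff m (1 : ℚ_[p]⟦X⟧) := by
  have hγ0 : constantCoeff γ = 0 := by
    obtain ⟨r, rfl⟩ := hγ
    simp
  rw [coeff_subst_eq_sum hγ0, Finset.sum_eq_single_of_mem 0 (by simp)]
  · simp
  · intro i _ hi
    obtain ⟨r, hr⟩ := hγ
    have : coeff m (γ ^ i) = 0 := by
      obtain ⟨j, rfl⟩ := Nat.exists_eq_succ_of_ne_zero hi
      rw [pow_succ, hr, show ((X : ℚ_[p]⟦X⟧) ^ (m + 1) * r) ^ j * (X ^ (m + 1) * r) =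
        X ^ (m + 1) * ((X ^ (m + 1) * r) ^ j * r) by ring, coeff_X_pow_mul']
      simp
    rw [this, mul_zero]

/-- Consequently tails `ℓ(γ) − ℓ(δ)` vanish below degree `m + 1` when `X^{m+1}` divides
`γ` and `δ`. [folklore] -/
theorem coeff_subst_sub_subst_of_X_pow_dvd {γ δ : ℚ_[p]⟦X⟧} (ℓ : ℚ_[p]⟦X⟧) {m : ℕ}
    (hγ : X ^ (m + 1) ∣ γ) (hδ : X ^ (m + 1) ∣ δ) : coeff m (ℓ.subst γ - ℓ.subst δ) = 0 := by
  rw [map_sub, coeff_subst_of_X_pow_dvd ℓ hγ, coeff_subst_of_X_pow_dvd ℓ hδ, sub_self]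

/-- `(C c · F)(γ) = C c · F(γ)`. [folklore] -/
theorem subst_C_mul' {γ : ℚ_[p]⟦X⟧} (hγ : HasSubst γ) (c : ℚ_[p]) (F : ℚ_[p]⟦X⟧) :
    (C c * F).subst γ = C c * F.subst γ := by
  rw [← smul_eq_C_mul, subst_smul hγ, smul_eq_C_mul]

/-- Substitution commutes with finite sums. [folklore] -/
theorem subst_finset_sum {ι : Type*} {γ : ℚ_[p]⟦X⟧} (hγ : HasSubst γ) (s : Finset ι)
    (F : ι → ℚ_[p]⟦X⟧) : (∑ i ∈ s, F i).subst γ = ∑ i ∈ s, (F i).subst γ := by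
  rw [← coe_substAlgHom hγ, map_sum]

/-- `(expand q g)(γ) = g(γ^q)`. [folklore] -/
theorem subst_expand {q : ℕ} (hq : q ≠ 0) {γ : ℚ_[p]⟦X⟧} (hγ : HasSubst γ) (g : ℚ_[p]⟦X⟧) :
    (expand q hq g).subst γ = g.subst (γ ^ q) := by
  rw [expand_apply, subst_comp_subst_apply (HasSubst.X_pow hq) hγ, subst_pow hγ, subst_X hγ]

/-- `expand q (ℓ(θ)) = ℓ(expand q θ)`. [folklore] -/
theorem expand_subst' {q : ℕ} (hq : q ≠ 0) {θ : ℚ_[p]⟦X⟧} (hθ : HasSubst θ) (ℓ : ℚ_[p]⟦X⟧) :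
    expand q hq (ℓ.subst θ) = ℓ.subst (expand q hq θ) :=
  expand_subst q hq hθ ℓ

end Subst

/-! ### The binomial congruence `α ≡ β (mod pˢ) ⇒ αᵖ ≡ βᵖ (mod p^{s+1})` (`s ≥ 1`) -/

section Binomial

/-- `‖(p choose j)‖_p ≤ p⁻¹` for `0 < j < p`. [folklore] -/
theorem norm_choose_le {j : ℕ} (hj0 : j ≠ 0) (hjp : j < p) :
    ‖((p.choose j : ℕ) : ℚ_[p])‖ ≤ (p : ℝ)⁻¹ := by
  have hdvd : (p : ℤ) ∣ (p.choose j : ℕ) := by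
    exact_mod_cast Nat.Prime.dvd_choose_self hp.out hj0 hjp
  have h := (Padic.norm_int_le_pow_iff_dvd ((p.choose j : ℕ) : ℤ) 1).mpr (by simpa using hdvd)
  simpa using h

/-- **`α ≡ β (mod pˢ)`, `s ≥ 1`, integral ⇒ `αᵖ ≡ βᵖ (mod p^{s+1})`.** [Hazewinkel 1978, I.2.3
(Lemma 2.3.2)] [folklore] -/
theorem norm_coeff_pow_prime_sub_le {α β : ℚ_[p]⟦X⟧} {s : ℕ} (hs : 1 ≤ s)
    (hβ : ∀ n, ‖coeff n β‖ ≤ 1)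
    (hαβ : ∀ n, ‖coeff n (α - β)‖ ≤ (p : ℝ)⁻¹ ^ s) (n : ℕ) :
    ‖coeff n (α ^ p - β ^ p)‖ ≤ (p : ℝ)⁻¹ ^ (s + 1) := by
  have hp1 : 1 < p := hp.out.one_lt
  have hpr : (0 : ℝ) ≤ (p : ℝ)⁻¹ := by positivity
  have hpr1 : (p : ℝ)⁻¹ ≤ 1 := inv_le_one_of_one_le₀ (by exact_mod_cast hp1.le)
  set δ := α - β with hδ
  have hδint : ∀ n, ‖coeff n δ‖ ≤ 1 := fun n ↦
    (hαβ n).trans ((pow_le_one₀ hpr hpr1).trans le_rfl)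
  have hexp : α ^ p - β ^ p =
      ∑ j ∈ Finset.range p, β ^ j * δ ^ (p - j) * ((p.choose j : ℕ) : ℚ_[p]⟦X⟧) := by
    have hαe : α = β + δ := by rw [hδ]; ring
    rw [hαe, add_pow, Finset.sum_range_succ, Nat.choose_self, Nat.sub_self, pow_zero, mul_one,
      Nat.cast_one, mul_one, add_sub_cancel_right]
  rw [hexp]
  refine norm_coeff_sum_le _ _ (pow_nonneg hpr _) (fun j hj m ↦ ?_) n
  rw [Finset.mem_range] at hj
  rw [show ((p.choose j : ℕ) : ℚ_[p]⟦X⟧) = C ((p.choose j : ℕ) : ℚ_[p]) by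
    rw [map_natCast], mul_comm, norm_coeff_C_mul]
  rcases Nat.eq_zero_or_pos j with rfl | hj0
  · -- `j = 0`: the term `δᵖ`, bounded by `p^{-sp} ≤ p^{-(s+1)}`
    rw [Nat.choose_zero_right, Nat.cast_one, norm_one, one_mul, pow_zero, one_mul, Nat.sub_zero]
    refine (norm_coeff_pow_le (pow_nonneg hpr s) hαβ p m).trans ?_
    rw [← pow_mul]
    refine pow_le_pow_of_le_one hpr hpr1 ?_
    calc s + 1 ≤ s + s := by omega
      _ = s * 2 := by ring
      _ ≤ s * p := Nat.mul_le_mul_left s hp1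
  · -- `0 < j < p`: `p ∣ (p choose j)` and `δ^{p-j}` with `p - j ≥ 1`
    have h1 : ‖coeff m (β ^ j * δ ^ (p - j))‖ ≤ (p : ℝ)⁻¹ ^ s := by
      refine norm_coeff_mul_le_of_le_one (pow_nonneg hpr s) (norm_coeff_pow_le_one hβ j) ?_ m
      intro m'
      refine (norm_coeff_pow_le (pow_nonneg hpr s) hαβ (p - j) m').trans ?_
      rw [← pow_mul]
      exact pow_le_pow_of_le_one hpr hpr1 (Nat.le_mul_of_pos_right s (by omega))
    calc ‖((p.choose j : ℕ) : ℚ_[p])‖ * ‖coeff m (β ^ j * δ ^ (p - j))‖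
        ≤ (p : ℝ)⁻¹ * (p : ℝ)⁻¹ ^ s :=
          mul_le_mul (norm_choose_le hj0.ne' hj) h1 (norm_nonneg _) hpr
      _ = (p : ℝ)⁻¹ ^ (s + 1) := by ring

/-- Iterating: `α ≡ β (mod pˢ)`, `s ≥ 1` ⇒ `α^{pᵏ} ≡ β^{pᵏ} (mod p^{s+k})`. [folklore] -/
theorem norm_coeff_pow_prime_pow_sub_le {α β : ℚ_[p]⟦X⟧} {s : ℕ} (hs : 1 ≤ s)
    (hβ : ∀ n, ‖coeff n β‖ ≤ 1)
    (hαβ : ∀ n, ‖coeff n (α - β)‖ ≤ (p : ℝ)⁻¹ ^ s) (k n : ℕ) :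
    ‖coeff n (α ^ p ^ k - β ^ p ^ k)‖ ≤ (p : ℝ)⁻¹ ^ (s + k) := by
  induction k generalizing n with
  | zero => simpa using hαβ n
  | succ k ih =>
    rw [pow_succ, pow_mul, pow_mul, ← add_assoc]
    exact norm_coeff_pow_prime_sub_le (by omega) (norm_coeff_pow_le_one hβ _) ih n

end Binomial

/-! ### The two-term functional equation `hondaShift` -/

section Shift

variable (p)

/-- `p ≠ 0`. [folklore] -/
theorem prime_ne_zero : p ≠ 0 := hp.out.ne_zero

/-- `p² ≠ 0`. [folklore] -/
theorem prime_sq_ne_zero : p ^ 2 ≠ 0 := pow_ne_zero 2 hp.out.ne_zero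

/-- **Honda's two-term functional equation operator** `ℓ ↦ ℓ − (a/p)·ℓ(Xᵖ) + (1/p)·ℓ(X^{p²})`
on `ℚ_p⟦X⟧`: `ℓ` is "of type `u = p − aT + T²`" iff `hondaShift p a ℓ ∈ ℤ_p⟦X⟧`, i.e. `ℓ = f_g` with
`g = hondaShift p a ℓ` in Hazewinkel's notation (`s₁ = a/p`, `s₂ = −1/p`). [Hazewinkel 1978, I.2.1;
Honda 1970, §2] [cite: Hazewinkel1978, Ch. I §2.1] -/
def hondaShift (a : ℚ_[p]) (ℓ : ℚ_[p]⟦X⟧) : ℚ_[p]⟦X⟧ :=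
  ℓ - C (a / p) * expand p (prime_ne_zero p) ℓ + C (1 / (p : ℚ_[p])) * expand (p ^ 2) (prime_sq_ne_zero p) ℓ

/-- Unfolding `hondaShift`. [folklore] -/
theorem hondaShift_def (a : ℚ_[p]) (ℓ : ℚ_[p]⟦X⟧) : hondaShift p a ℓ =
    ℓ - C (a / p) * expand p (prime_ne_zero p) ℓ +
      C (1 / (p : ℚ_[p])) * expand (p ^ 2) (prime_sq_ne_zero p) ℓ := rfl

/-- `ℓ = hondaShift ℓ + (a/p)·ℓ(Xᵖ) − (1/p)·ℓ(X^{p²})` (the functional equation of `ℓ = f_g`).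
[Hazewinkel 1978, I.2.1 (2.1.3)] [folklore] -/
theorem eq_hondaShift_add (a : ℚ_[p]) (ℓ : ℚ_[p]⟦X⟧) :
    ℓ = hondaShift p a ℓ + C (a / p) * expand p (prime_ne_zero p) ℓ -
      C (1 / (p : ℚ_[p])) * expand (p ^ 2) (prime_sq_ne_zero p) ℓ := by
  rw [hondaShift_def]; ring

/-- **The coefficients of `hondaShift`**: `[Xⁿ] = ℓₙ − (a/p)·ℓ_{n/p} + (1/p)·ℓ_{n/p²}` (the last two
only when `p ∣ n`, resp. `p² ∣ n`). [Hazewinkel 1978, I.2.1] [folklore] -/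
theorem coeff_hondaShift (a : ℚ_[p]) (ℓ : ℚ_[p]⟦X⟧) (n : ℕ) :
    coeff n (hondaShift p a ℓ) = coeff n ℓ - a / p * (if p ∣ n then coeff (n / p) ℓ else 0) +
      1 / (p : ℚ_[p]) * (if p ^ 2 ∣ n then coeff (n / p ^ 2) ℓ else 0) := by
  rw [hondaShift_def, map_add, map_sub, coeff_C_mul, coeff_C_mul, coeff_expand, coeff_expand]

/-- `hondaShift` is additive. [folklore] -/
theorem hondaShift_add (a : ℚ_[p]) (ℓ ℓ' : ℚ_[p]⟦X⟧) :
    hondaShift p a (ℓ + ℓ') = hondaShift p a ℓ + hondaShift p a ℓ' := by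
  simp only [hondaShift_def, map_add]; ring

/-- `hondaShift` is `ℚ_p`-linear. [folklore] -/
theorem hondaShift_C_mul (a c : ℚ_[p]) (ℓ : ℚ_[p]⟦X⟧) :
    hondaShift p a (C c * ℓ) = C c * hondaShift p a ℓ := by
  simp only [hondaShift_def, map_mul, expand_C]; ring

variable {p}

/-- **Reading off `a` modulo `p`.** If `ℓ` is of type `p − aT + T²` then
`‖p·[Xᵖ]ℓ − a·[X¹]ℓ‖ ≤ p⁻¹`: the coefficient of `Xᵖ` of `hondaShift` is `ℓ_p − (a/p)ℓ₁`.
[Honda 1970, §2 (the type determines `a mod p`)] [folklore] -/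
theorem norm_prime_mul_coeff_sub_le {a : ℚ_[p]} {ℓ : ℚ_[p]⟦X⟧}
    (hT : ∀ n, ‖coeff n (hondaShift p a ℓ)‖ ≤ 1) :
    ‖(p : ℚ_[p]) * coeff p ℓ - a * coeff 1 ℓ‖ ≤ (p : ℝ)⁻¹ := by
  have hp1 : 1 < p := hp.out.one_lt
  have h := hT p
  rw [coeff_hondaShift, if_pos (dvd_refl p), Nat.div_self hp.out.pos, if_neg] at h
  · rw [mul_zero, add_zero] at h
    have hp0 : (p : ℚ_[p]) ≠ 0 := by exact_mod_cast hp.out.ne_zero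
    have e : (p : ℚ_[p]) * coeff p ℓ - a * coeff 1 ℓ = p * (coeff p ℓ - a / p * coeff 1 ℓ) := by
      field_simp
    rw [e, norm_mul, Padic.norm_p]
    calc (p : ℝ)⁻¹ * ‖coeff p ℓ - a / p * coeff 1 ℓ‖ ≤ (p : ℝ)⁻¹ * 1 := by gcongr
      _ = (p : ℝ)⁻¹ := mul_one _
  · intro h2
    have : p ^ 2 ≤ p := Nat.le_of_dvd hp.out.pos h2
    have : p < p ^ 2 := lt_self_pow₀ hp1 (by norm_num)
    omega

/-- **Reading off `a` modulo `p`, integer form.** If `ℓ = X + ⋯` is of type `p − aT + T²` with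
`a ∈ ℤ` and `p·[Xᵖ]ℓ = c ∈ ℤ` (for a formal-group logarithm, `c` is the coefficient `c_{p-1}` of
the invariant differential), then `p ∣ c − a`. [Honda 1970, §2] [folklore] -/
theorem dvd_sub_of_hondaShift {a c : ℤ} {ℓ : ℚ_[p]⟦X⟧}
    (hT : ∀ n, ‖coeff n (hondaShift p a ℓ)‖ ≤ 1) (h1 : coeff 1 ℓ = 1)
    (hc : (p : ℚ_[p]) * coeff p ℓ = c) : (p : ℤ) ∣ c - a := by
  have h := norm_prime_mul_coeff_sub_le hT
  rw [h1, mul_one, hc, ← Int.cast_sub] at h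
  have h' := (Padic.norm_int_le_pow_iff_dvd (c - a) 1).mp (by simpa using h)
  simpa using h'

end Shift

/-! ### The Hecke recursion `a_{pn} = a_p aₙ − p a_{n/p}` gives the type `p − a_pT + T²` -/

section Hecke

/-- **`hondaShift` of `Σ aₙXⁿ/n` under the Hecke recursion at `p`**: if
`a_{pn} = a_p·aₙ − p·a_{n/p}` for all `n ≥ 1` (`a_{n/p} := 0` if `p ∤ n`) and `a₀ = 0`, then
`hondaShift p a_p (Σ aₙXⁿ/n) = Σ_{p ∤ n} aₙXⁿ/n` — the functional equation holds *exactly* at the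
multiples of `p`. (For the `L`-series of a weight-`2` eigenform and `p ∤ N` this is
`T_pTₙ = T_{pn} + pT_{n/p}`; for an elliptic curve, Honda 1968, §4.) [Honda 1970, Thm. 8;
Honda 1968, Thm. 5] [cite: Honda1970, Thm. 8] -/
theorem coeff_hondaShift_mk_div (a : ℕ → ℚ_[p]) (ha0 : a 0 = 0)
    (hrec : ∀ n, 0 < n → a (p * n) = a p * a n - p * (if p ∣ n then a (n / p) else 0)) (n : ℕ) :
    coeff n (hondaShift p (a p) (PowerSeries.mk fun k ↦ a k / k)) =
      if p ∣ n then 0 else a n / n := by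
  have hp0 : (p : ℚ_[p]) ≠ 0 := by exact_mod_cast hp.out.ne_zero
  have hpp : 0 < p := hp.out.pos
  rw [coeff_hondaShift]
  simp only [coeff_mk]
  by_cases hpn : p ∣ n
  · rw [if_pos hpn, if_pos hpn]
    obtain ⟨m, rfl⟩ := hpn
    rw [Nat.mul_div_cancel_left m hpp]
    rcases Nat.eq_zero_or_pos m with rfl | hm
    · simp [ha0]
    · have hrel := hrec m hm
      by_cases hpm : p ∣ m
      · obtain ⟨k, rfl⟩ := hpm
        have hk : 0 < k := Nat.pos_of_mul_pos_left hm
        rw [if_pos (by rw [pow_two]; exact Nat.mul_dvd_mul_left p (dvd_mul_right p k)),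
          show p * (p * k) / p ^ 2 = k by
            rw [pow_two, ← mul_assoc, Nat.mul_div_cancel_left k (Nat.mul_pos hpp hpp)]]
        rw [if_pos (dvd_mul_right p k), Nat.mul_div_cancel_left k hpp] at hrel
        rw [hrel]
        have hk0 : (k : ℚ_[p]) ≠ 0 := by exact_mod_cast hk.ne'
        push_cast
        field_simp
        ring
      · rw [if_neg (fun h ↦ hpm ?_)]
        · rw [if_neg hpm, mul_zero, sub_zero] at hrel
          rw [hrel]
          have hm0 : (m : ℚ_[p]) ≠ 0 := by exact_mod_cast hm.ne'
          push_cast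
          field_simp
          ring
        · rw [pow_two] at h
          exact Nat.dvd_of_mul_dvd_mul_left hpp h
  · rw [if_neg hpn, if_neg hpn, if_neg (fun h ↦ hpn (dvd_trans (dvd_pow_self p two_ne_zero) h))]
    ring

/-- **The Hecke recursion gives the type `p − a_pT + T²`** (integral version): if moreover all
`aₙ ∈ ℤ_p`, then `hondaShift p a_p (Σ aₙXⁿ/n) ∈ ℤ_p⟦X⟧` (for `p ∤ n`, `‖aₙ/n‖ = ‖aₙ‖ ≤ 1`).
[Honda 1970, Thm. 8; Hazewinkel 1978, I.2.2] [cite: Honda1970, Thm. 8] -/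
theorem norm_coeff_hondaShift_mk_div_le_one (a : ℕ → ℚ_[p]) (ha0 : a 0 = 0)
    (hrec : ∀ n, 0 < n → a (p * n) = a p * a n - p * (if p ∣ n then a (n / p) else 0))
    (hint : ∀ n, ‖a n‖ ≤ 1) (n : ℕ) :
    ‖coeff n (hondaShift p (a p) (PowerSeries.mk fun k ↦ a k / k))‖ ≤ 1 := by
  rw [coeff_hondaShift_mk_div a ha0 hrec]
  split_ifs with h
  · simp
  · have hn : ‖(n : ℚ_[p])‖ = 1 := by
      rw [Padic.norm_natCast_eq_one_iff]
      exact (Nat.Prime.coprime_iff_not_dvd hp.out).mpr h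
    rw [norm_div, hn, div_one]
    exact hint n

end Hecke

/-! ### Finite iteration of the functional equation -/

section Iterate

variable (p)

/-- The coefficients `b_k` of the iterated functional equation: `b₀ = 1`, `b₁ = a/p`,
`b_{k+2} = (a/p)b_{k+1} − (1/p)b_k` (so that `ℓ = Σ_k b_k g(X^{p^k})`; `‖b_k‖ ≤ pᵏ`).
[Hazewinkel 1978, I.2.3 (proof of the functional equation lemma)] [cite: Hazewinkel1978, Ch. I §2.3] -/
def hondaB (a : ℚ_[p]) : ℕ → ℚ_[p]
  | 0 => 1
  | 1 => a / p
  | k + 2 => a / p * hondaB a (k + 1) - 1 / p * hondaB a k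

/-- `b₀ = 1`. [folklore] -/
@[simp] theorem hondaB_zero (a : ℚ_[p]) : hondaB p a 0 = 1 := rfl

/-- `b₁ = a/p`. [folklore] -/
@[simp] theorem hondaB_one (a : ℚ_[p]) : hondaB p a 1 = a / p := rfl

/-- `b_{k+2} = (a/p)b_{k+1} − (1/p)b_k`. [folklore] -/
theorem hondaB_add_two (a : ℚ_[p]) (k : ℕ) :
    hondaB p a (k + 2) = a / p * hondaB p a (k + 1) - 1 / p * hondaB p a k := rfl

variable {p}

/-- **`‖b_k‖ ≤ pᵏ`** for `a ∈ ℤ_p`. [Hazewinkel 1978, I.2.3] [folklore] -/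
theorem norm_hondaB_le {a : ℚ_[p]} (ha : ‖a‖ ≤ 1) (k : ℕ) : ‖hondaB p a k‖ ≤ (p : ℝ) ^ k := by
  have hp1 : (1 : ℝ) ≤ p := by exact_mod_cast hp.out.one_lt.le
  have hap : ‖a / p‖ ≤ p := by
    rw [norm_div, Padic.norm_p, div_inv_eq_mul]
    calc ‖a‖ * p ≤ 1 * p := by gcongr
      _ = p := one_mul _
  have h1p : ‖(1 : ℚ_[p]) / p‖ ≤ p := by
    rw [norm_div, norm_one, Padic.norm_p, one_div, inv_inv]
  induction k using Nat.strong_induction_on with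
  | _ k ih =>
    match k, ih with
    | 0, _ => simp
    | 1, _ => simpa using hap
    | k + 2, ih =>
      rw [hondaB_add_two, sub_eq_add_neg]
      refine (IsUltrametricDist.norm_add_le_max _ _).trans (max_le ?_ ?_)
      · rw [norm_mul]
        calc ‖a / p‖ * ‖hondaB p a (k + 1)‖ ≤ p * (p : ℝ) ^ (k + 1) :=
              mul_le_mul hap (ih (k + 1) (by omega)) (norm_nonneg _) (by positivity)
          _ = (p : ℝ) ^ (k + 2) := by ring
      · rw [norm_neg, norm_mul]
        calc ‖(1 : ℚ_[p]) / p‖ * ‖hondaB p a k‖ ≤ p * (p : ℝ) ^ k :=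
              mul_le_mul h1p (ih k (by omega)) (norm_nonneg _) (by positivity)
          _ = (p : ℝ) ^ (k + 1) := by ring
          _ ≤ (p : ℝ) ^ (k + 2) := pow_le_pow_right₀ hp1 (by omega)

/-- `expand m (expand n f) = expand (m·n) f`. [folklore] -/
theorem expand_expand {m n : ℕ} (hm : m ≠ 0) (hn : n ≠ 0) (f : ℚ_[p]⟦X⟧) :
    expand m hm (expand n hn f) = expand (m * n) (Nat.mul_ne_zero hm hn) f :=
  (expand_mul m hm n hn f).symm

/-- `expand` only depends on the exponent. [folklore] -/
theorem expand_congr {m n : ℕ} (h : m = n) (hm : m ≠ 0) (hn : n ≠ 0) (f : ℚ_[p]⟦X⟧) :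
    expand m hm f = expand n hn f := by
  subst h; rfl

/-- `expand (p^i) (expand (p^j) f) = expand (p^(i+j)) f`. [folklore] -/
theorem expand_pow_expand_pow (i j : ℕ) (f : ℚ_[p]⟦X⟧) :
    expand (p ^ i) (pow_ne_zero i (prime_ne_zero p)) (expand (p ^ j) (pow_ne_zero j (prime_ne_zero p)) f) =
      expand (p ^ (i + j)) (pow_ne_zero (i + j) (prime_ne_zero p)) f := by
  rw [expand_expand]
  exact expand_congr (by rw [pow_add]) _ _ f

/-- **The functional equation iterated `K + 1` times**: with `g = hondaShift p a ℓ`,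
`ℓ = Σ_{k ≤ K} b_k·g(X^{p^k}) + b_{K+1}·ℓ(X^{p^{K+1}}) − (b_K/p)·ℓ(X^{p^{K+2}})`.
[Hazewinkel 1978, I.2.3 (the expansion `f_g = Σ b_k σ^k_* g(X^{p^k})`, truncated)]
[cite: Hazewinkel1978, Ch. I §2.3] -/
theorem hondaShift_iterate (a : ℚ_[p]) (ℓ : ℚ_[p]⟦X⟧) (K : ℕ) :
    ℓ = (∑ k ∈ Finset.range (K + 1), C (hondaB p a k) *
          expand (p ^ k) (pow_ne_zero k (prime_ne_zero p)) (hondaShift p a ℓ)) +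
        C (hondaB p a (K + 1)) * expand (p ^ (K + 1)) (pow_ne_zero (K + 1) (prime_ne_zero p)) ℓ -
        C (1 / (p : ℚ_[p]) * hondaB p a K) *
          expand (p ^ (K + 2)) (pow_ne_zero (K + 2) (prime_ne_zero p)) ℓ := by
  induction K with
  | zero =>
    rw [Finset.sum_range_one, hondaB_zero, hondaB_one, map_one, one_mul, mul_one]
    have e0 : expand (p ^ 0) (pow_ne_zero 0 (prime_ne_zero p)) (hondaShift p a ℓ) = hondaShift p a ℓ := by
      rw [expand_congr (pow_zero p) _ one_ne_zero, expand_one_apply]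
    have e1 : expand (p ^ (0 + 1)) (pow_ne_zero (0 + 1) (prime_ne_zero p)) ℓ =
        expand p (prime_ne_zero p) ℓ := expand_congr (by ring) _ _ ℓ
    have e2 : expand (p ^ (0 + 2)) (pow_ne_zero (0 + 2) (prime_ne_zero p)) ℓ =
        expand (p ^ 2) (prime_sq_ne_zero p) ℓ := expand_congr (by ring) _ _ ℓ
    rw [e0, e1, e2]
    exact eq_hondaShift_add p a ℓ
  | succ K ih =>
    -- expand the middle term once more with the functional equation
    have hmid : expand (p ^ (K + 1)) (pow_ne_zero (K + 1) (prime_ne_zero p)) ℓ =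
        expand (p ^ (K + 1)) (pow_ne_zero (K + 1) (prime_ne_zero p)) (hondaShift p a ℓ) +
          C (a / p) * expand (p ^ (K + 2)) (pow_ne_zero (K + 2) (prime_ne_zero p)) ℓ -
          C (1 / (p : ℚ_[p])) * expand (p ^ (K + 3)) (pow_ne_zero (K + 3) (prime_ne_zero p)) ℓ := by
      conv_lhs => rw [eq_hondaShift_add p a ℓ]
      rw [map_sub, map_add, map_mul, map_mul, expand_C, expand_C]
      have h1 : expand (p ^ (K + 1)) (pow_ne_zero (K + 1) (prime_ne_zero p))
          (expand p (prime_ne_zero p) ℓ) =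
          expand (p ^ (K + 2)) (pow_ne_zero (K + 2) (prime_ne_zero p)) ℓ := by
        have := expand_pow_expand_pow (p := p) (K + 1) 1 ℓ
        rw [expand_congr (pow_one p) _ (prime_ne_zero p)] at this
        rw [this]
      have h2 : expand (p ^ (K + 1)) (pow_ne_zero (K + 1) (prime_ne_zero p))
          (expand (p ^ 2) (prime_sq_ne_zero p) ℓ) =
          expand (p ^ (K + 3)) (pow_ne_zero (K + 3) (prime_ne_zero p)) ℓ :=
        expand_pow_expand_pow (p := p) (K + 1) 2 ℓ
      rw [h1, h2]
    rw [Finset.sum_range_succ, hondaB_add_two]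
    conv_lhs => rw [ih, hmid]
    simp only [map_sub, map_mul]
    ring

end Iterate

/-! ### The functional equation lemma, part (iv) -/

section FEiv

/-- **Functional equation lemma (iv).** Let `ℓ ∈ ℚ_p⟦X⟧` be of type `p − aT + T²` (`a ∈ ℤ_p`),
and let `α, β ∈ Xℤ_p⟦X⟧` with `α ≡ β (mod pʳ)`, `r ≥ 1`. Then `ℓ(α) ≡ ℓ(β) (mod pʳ)`.
[Hazewinkel 1978, Ch. I, 2.2 (iv) (functional equation lemma), proof in 2.3]
[cite: Hazewinkel1978, Ch. I §2.2 (iv)] -/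
theorem norm_coeff_subst_sub_subst_le {a : ℚ_[p]} (ha : ‖a‖ ≤ 1) {ℓ : ℚ_[p]⟦X⟧}
    (hT : ∀ n, ‖coeff n (hondaShift p a ℓ)‖ ≤ 1) {α β : ℚ_[p]⟦X⟧}
    (hα0 : constantCoeff α = 0) (hβ0 : constantCoeff β = 0)
    (hα : ∀ n, ‖coeff n α‖ ≤ 1) (hβ : ∀ n, ‖coeff n β‖ ≤ 1) {r : ℕ} (hr : 1 ≤ r)
    (hαβ : ∀ n, ‖coeff n (α - β)‖ ≤ (p : ℝ)⁻¹ ^ r) (n : ℕ) :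
    ‖coeff n (ℓ.subst α - ℓ.subst β)‖ ≤ (p : ℝ)⁻¹ ^ r := by
  have hpr : (0 : ℝ) ≤ (p : ℝ)⁻¹ := by positivity
  have hsα : HasSubst α := HasSubst.of_constantCoeff_zero' hα0
  have hsβ : HasSubst β := HasSubst.of_constantCoeff_zero' hβ0
  set g := hondaShift p a ℓ with hg
  -- substitute `α` and `β` into the `n`-fold iterated functional equation
  have hiter := hondaShift_iterate a ℓ n
  have key : ℓ.subst α - ℓ.subst β =
      (∑ k ∈ Finset.range (n + 1), C (hondaB p a k) *
          (g.subst (α ^ p ^ k) - g.subst (β ^ p ^ k))) +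
        C (hondaB p a (n + 1)) * (ℓ.subst (α ^ p ^ (n + 1)) - ℓ.subst (β ^ p ^ (n + 1))) -
        C (1 / (p : ℚ_[p]) * hondaB p a n) *
          (ℓ.subst (α ^ p ^ (n + 2)) - ℓ.subst (β ^ p ^ (n + 2))) := by
    have hsub : ∀ {γ : ℚ_[p]⟦X⟧} (hγ : HasSubst γ), ℓ.subst γ =
        (∑ k ∈ Finset.range (n + 1), C (hondaB p a k) * g.subst (γ ^ p ^ k)) +
          C (hondaB p a (n + 1)) * ℓ.subst (γ ^ p ^ (n + 1)) -
          C (1 / (p : ℚ_[p]) * hondaB p a n) * ℓ.subst (γ ^ p ^ (n + 2)) := by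
      intro γ hγ
      conv_lhs => rw [hiter]
      rw [subst_sub hγ, subst_add hγ, subst_finset_sum hγ]
      simp only [subst_C_mul' hγ, subst_expand _ hγ, hg]
    rw [hsub hsα, hsub hsβ]
    simp only [mul_sub, Finset.sum_sub_distrib]
    ring
  rw [key, map_sub, map_add]
  -- the two tail terms vanish in degree `n < p^{n+1}`
  have hXα : ∀ k, n + 1 ≤ k → X ^ (n + 1) ∣ α ^ k := fun k hk ↦ by
    have : X ∣ α := by rwa [X_dvd_iff]
    exact (pow_dvd_pow X hk).trans (pow_dvd_pow_of_dvd this k)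
  have hXβ : ∀ k, n + 1 ≤ k → X ^ (n + 1) ∣ β ^ k := fun k hk ↦ by
    have : X ∣ β := by rwa [X_dvd_iff]
    exact (pow_dvd_pow X hk).trans (pow_dvd_pow_of_dvd this k)
  have hnp : ∀ j, n + 1 ≤ p ^ (n + j) := fun j ↦
    (Nat.lt_pow_self hp.out.one_lt).trans_le (Nat.pow_le_pow_right hp.out.pos (Nat.le_add_right n j))
  have ht1 : coeff n (C (hondaB p a (n + 1)) *
      (ℓ.subst (α ^ p ^ (n + 1)) - ℓ.subst (β ^ p ^ (n + 1)))) = 0 := by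
    rw [coeff_C_mul, coeff_subst_sub_subst_of_X_pow_dvd ℓ (hXα _ (hnp 1)) (hXβ _ (hnp 1)),
      mul_zero]
  have ht2 : coeff n (C (1 / (p : ℚ_[p]) * hondaB p a n) *
      (ℓ.subst (α ^ p ^ (n + 2)) - ℓ.subst (β ^ p ^ (n + 2)))) = 0 := by
    rw [coeff_C_mul, coeff_subst_sub_subst_of_X_pow_dvd ℓ (hXα _ (hnp 2)) (hXβ _ (hnp 2)),
      mul_zero]
  rw [ht1, ht2, add_zero, sub_zero, map_sum]
  refine IsUltrametricDist.norm_sum_le_of_forall_le_of_nonneg (pow_nonneg hpr r) fun k _ ↦ ?_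
  rw [coeff_C_mul, norm_mul]
  -- `‖b_k‖ ≤ p^k` and `g(α^{p^k}) ≡ g(β^{p^k}) (mod p^{r+k})`
  have hdiff : ‖coeff n (g.subst (α ^ p ^ k) - g.subst (β ^ p ^ k))‖ ≤ (p : ℝ)⁻¹ ^ (r + k) := by
    refine norm_coeff_subst_sub_subst_le_of_integral (pow_nonneg hpr _) ?_ ?_ hT
      (norm_coeff_pow_le_one hα _) (norm_coeff_pow_le_one hβ _)
      (norm_coeff_pow_prime_pow_sub_le hr hβ hαβ k) n
    · rw [map_pow, hα0, zero_pow (pow_ne_zero k hp.out.ne_zero)]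
    · rw [map_pow, hβ0, zero_pow (pow_ne_zero k hp.out.ne_zero)]
  calc ‖hondaB p a k‖ * ‖coeff n (g.subst (α ^ p ^ k) - g.subst (β ^ p ^ k))‖
      ≤ (p : ℝ) ^ k * (p : ℝ)⁻¹ ^ (r + k) :=
        mul_le_mul (norm_hondaB_le ha k) hdiff (norm_nonneg _) (by positivity)
    _ = (p : ℝ)⁻¹ ^ r := by
        have hp0 : (p : ℝ) ≠ 0 := by exact_mod_cast hp.out.ne_zero
        rw [pow_add, mul_comm ((p : ℝ)⁻¹ ^ r), ← mul_assoc, ← mul_pow, mul_inv_cancel₀ hp0,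
          one_pow, one_mul]

end FEiv

/-! ### Frobenius: `θᵖ ≡ θ(Xᵖ) (mod p)` for `θ ∈ ℤ_p⟦X⟧` -/

section Frobenius

/-- An integral series of `ℚ_p⟦X⟧`, as a series over `ℤ_p` (data). [folklore] -/
def liftInt (θ : ℚ_[p]⟦X⟧) (hθ : ∀ n, ‖coeff n θ‖ ≤ 1) : ℤ_[p]⟦X⟧ :=
  PowerSeries.mk fun n ↦ ⟨coeff n θ, hθ n⟩

/-- `liftInt θ ↦ θ` under `ℤ_p → ℚ_p`. [folklore] -/
theorem map_liftInt (θ : ℚ_[p]⟦X⟧) (hθ : ∀ n, ‖coeff n θ‖ ≤ 1) :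
    (liftInt θ hθ).map PadicInt.Coe.ringHom = θ := by
  ext n
  rw [coeff_map, liftInt, coeff_mk]
  rfl

/-- Coefficients of `expand` are among those of the series (or `0`). [folklore] -/
theorem norm_coeff_expand_le {q : ℕ} (hq : q ≠ 0) {θ : ℚ_[p]⟦X⟧} {A : ℝ} (hA : 0 ≤ A)
    (hθ : ∀ n, ‖coeff n θ‖ ≤ A) (n : ℕ) : ‖coeff n (expand q hq θ)‖ ≤ A := by
  rw [coeff_expand]
  split_ifs
  · exact hθ _
  · simpa using hA

/-- In `𝔽_p⟦X⟧`, `Fᵖ = F(Xᵖ)`. [folklore] -/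
theorem pow_prime_eq_expand_zmod (F : (ZMod p)⟦X⟧) : F ^ p = expand p (prime_ne_zero p) F := by
  haveI : ExpChar (ZMod p) p := ExpChar.prime hp.out
  have h := MvPowerSeries.map_frobenius_expand p (prime_ne_zero p) (f := F)
  rw [ZMod.frobenius_zmod, MvPowerSeries.map_id] at h
  exact h.symm

/-- For `Θ ∈ ℤ_p⟦X⟧` every coefficient of `Θᵖ − Θ(Xᵖ)` has norm `≤ p⁻¹`. [folklore] -/
theorem norm_coeff_pow_sub_expand_le_int (Θ : ℤ_[p]⟦X⟧) (n : ℕ) :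
    ‖coeff n (Θ ^ p - expand p (prime_ne_zero p) Θ)‖ ≤ (p : ℝ)⁻¹ := by
  have hD : (Θ ^ p - expand p (prime_ne_zero p) Θ).map (PadicInt.toZMod (p := p)) = 0 := by
    rw [map_sub, map_pow, map_expand, sub_eq_zero]
    exact pow_prime_eq_expand_zmod _
  have h0 : PadicInt.toZMod (coeff n (Θ ^ p - expand p (prime_ne_zero p) Θ)) = 0 := by
    rw [← coeff_map, hD, map_zero]
  have hmem : coeff n (Θ ^ p - expand p (prime_ne_zero p) Θ) ∈ RingHom.ker (PadicInt.toZMod (p := p)) :=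
    h0
  rw [PadicInt.ker_toZMod, IsLocalRing.mem_maximalIdeal, mem_nonunits_iff,
    PadicInt.not_isUnit_iff] at hmem
  have := (PadicInt.norm_le_pow_iff_norm_lt_pow_add_one _ (-1)).mpr (by simpa using hmem)
  simpa using this

/-- **Frobenius modulo `p`**: for `θ ∈ ℤ_p⟦X⟧` (inside `ℚ_p⟦X⟧`), `θᵖ ≡ θ(Xᵖ) (mod p)`.
[Hazewinkel 1978, I.2.3 (used in the proof of (iii))] [folklore] -/
theorem norm_coeff_pow_sub_expand_le {θ : ℚ_[p]⟦X⟧} (hθ : ∀ n, ‖coeff n θ‖ ≤ 1) (n : ℕ) :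
    ‖coeff n (θ ^ p - expand p (prime_ne_zero p) θ)‖ ≤ (p : ℝ)⁻¹ := by
  have hmap : (liftInt θ hθ ^ p - expand p (prime_ne_zero p) (liftInt θ hθ)).map PadicInt.Coe.ringHom =
      θ ^ p - expand p (prime_ne_zero p) θ := by
    rw [map_sub, map_pow, map_expand, map_liftInt]
  rw [← hmap, coeff_map]
  exact norm_coeff_pow_sub_expand_le_int (liftInt θ hθ) n

/-- And `θ^{p²} ≡ θ(X^{p²}) (mod p)`. [folklore] -/
theorem norm_coeff_pow_sq_sub_expand_le {θ : ℚ_[p]⟦X⟧} (hθ : ∀ n, ‖coeff n θ‖ ≤ 1) (n : ℕ) :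
    ‖coeff n (θ ^ p ^ 2 - expand (p ^ 2) (prime_sq_ne_zero p) θ)‖ ≤ (p : ℝ)⁻¹ := by
  have hpr : (0 : ℝ) ≤ (p : ℝ)⁻¹ := by positivity
  have hpr1 : (p : ℝ)⁻¹ ≤ 1 := inv_le_one_of_one_le₀ (by exact_mod_cast hp.out.one_lt.le)
  -- `θ^{p²} − (θ(Xᵖ))ᵖ`, then `(θ(Xᵖ))ᵖ − θ(Xᵖ)(Xᵖ) = … − θ(X^{p²})`
  have h1 : ∀ m, ‖coeff m ((θ ^ p) ^ p - (expand p (prime_ne_zero p) θ) ^ p)‖ ≤ (p : ℝ)⁻¹ := by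
    intro m
    have h := norm_coeff_pow_prime_sub_le (s := 1) le_rfl
      (norm_coeff_expand_le _ zero_le_one hθ) (by simpa using norm_coeff_pow_sub_expand_le hθ) m
    exact h.trans (by rw [pow_succ, pow_one]; exact mul_le_of_le_one_left hpr hpr1)
  have h2 : ∀ m, ‖coeff m ((expand p (prime_ne_zero p) θ) ^ p -
      expand (p ^ 2) (prime_sq_ne_zero p) θ)‖ ≤ (p : ℝ)⁻¹ := by
    intro m
    have h := norm_coeff_pow_sub_expand_le (θ := expand p (prime_ne_zero p) θ)
      (norm_coeff_expand_le (prime_ne_zero p) zero_le_one hθ) m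
    rwa [expand_expand, expand_congr (by ring : p * p = p ^ 2) _ (prime_sq_ne_zero p)] at h
  have e : θ ^ p ^ 2 - expand (p ^ 2) (prime_sq_ne_zero p) θ =
      ((θ ^ p) ^ p - (expand p (prime_ne_zero p) θ) ^ p) +
        ((expand p (prime_ne_zero p) θ) ^ p - expand (p ^ 2) (prime_sq_ne_zero p) θ) := by
    ring
  rw [e]
  exact norm_coeff_add_le h1 h2 n

end Frobenius

/-! ### The functional equation lemma, part (iii): transport of the type -/

section FEiii

/-- **Functional equation lemma (iii) — transport of Honda's type along integral substitutions.**
Let `ℓ ∈ ℚ_p⟦X⟧` be of type `u = p − aT + T²` (`a ∈ ℤ_p`), i.e. `ℓ − (a/p)ℓ(Xᵖ) + (1/p)ℓ(X^{p²})`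
has `p`-integral coefficients, and let `θ ∈ ℤ_p⟦X⟧` with `θ(0) = 0`. Then `ℓ ∘ θ` is again of
type `u`. (Hazewinkel: "if `h(X) ∈ A⟦X⟧` then `f_g(h(X)) = f_ĝ(X)` for some `ĝ ∈ A⟦X⟧`"; with
`A = ℤ_p`, `σ = id`, `s₁ = a/p`, `s₂ = −1/p`; Honda: "`u∗(f∘ψ) ≡ (u∗f)∘ψ mod 𝔭`" for
`ψ ∈ 𝔬⟦x′⟧₀`.) This is the step by which the type of the logarithm `Σ aₙqⁿ/n` of a modular
parametrisation passes to the formal logarithm of the curve (Honda 1970, §6.2, `g = f∘φ`).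
[cite: Honda1970, Lemma 2.3 (p. 222)] [cite: Hazewinkel1978, Ch. I §2.2 (iii)] -/
theorem norm_coeff_hondaShift_subst_le_one {a : ℚ_[p]} (ha : ‖a‖ ≤ 1) {ℓ : ℚ_[p]⟦X⟧}
    (hT : ∀ n, ‖coeff n (hondaShift p a ℓ)‖ ≤ 1) {θ : ℚ_[p]⟦X⟧} (hθ0 : constantCoeff θ = 0)
    (hθ : ∀ n, ‖coeff n θ‖ ≤ 1) (n : ℕ) : ‖coeff n (hondaShift p a (ℓ.subst θ))‖ ≤ 1 := by
  have hp0 : (p : ℚ_[p]) ≠ 0 := by exact_mod_cast hp.out.ne_zero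
  have hpr : (0 : ℝ) ≤ (p : ℝ)⁻¹ := by positivity
  have hsθ : HasSubst θ := HasSubst.of_constantCoeff_zero' hθ0
  -- decomposition of `hondaShift (ℓ ∘ θ)`
  have h1 : ℓ.subst θ = (hondaShift p a ℓ).subst θ + C (a / p) * ℓ.subst (θ ^ p) -
      C (1 / (p : ℚ_[p])) * ℓ.subst (θ ^ p ^ 2) := by
    conv_lhs => rw [eq_hondaShift_add p a ℓ]
    rw [subst_sub hsθ, subst_add hsθ, subst_C_mul' hsθ, subst_C_mul' hsθ, subst_expand _ hsθ,
      subst_expand _ hsθ]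
  have key : hondaShift p a (ℓ.subst θ) = (hondaShift p a ℓ).subst θ +
      C (a / p) * (ℓ.subst (θ ^ p) - ℓ.subst (expand p (prime_ne_zero p) θ)) -
      C (1 / (p : ℚ_[p])) * (ℓ.subst (θ ^ p ^ 2) - ℓ.subst (expand (p ^ 2) (prime_sq_ne_zero p) θ)) := by
    rw [hondaShift_def p a (ℓ.subst θ), expand_subst' (prime_ne_zero p) hsθ ℓ,
      expand_subst' (prime_sq_ne_zero p) hsθ ℓ, h1]
    ring
  rw [key]
  -- the three pieces are integral
  have hθp0 : constantCoeff (θ ^ p) = 0 := by rw [map_pow, hθ0, zero_pow hp.out.ne_zero]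
  have hθp20 : constantCoeff (θ ^ p ^ 2) = 0 := by
    rw [map_pow, hθ0, zero_pow (pow_ne_zero 2 hp.out.ne_zero)]
  have he0 : constantCoeff (expand p (prime_ne_zero p) θ) = 0 := by rw [constantCoeff_expand, hθ0]
  have he20 : constantCoeff (expand (p ^ 2) (prime_sq_ne_zero p) θ) = 0 := by
    rw [constantCoeff_expand, hθ0]
  have A0 : ∀ m, ‖coeff m ((hondaShift p a ℓ).subst θ)‖ ≤ 1 := norm_coeff_subst_le_one hθ0 hT hθ
  have A1 : ∀ m, ‖coeff m (C (a / p) * (ℓ.subst (θ ^ p) - ℓ.subst (expand p (prime_ne_zero p) θ)))‖ ≤ 1 := by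
    intro m
    rw [norm_coeff_C_mul]
    have h := norm_coeff_subst_sub_subst_le ha hT hθp0 he0 (norm_coeff_pow_le_one hθ p)
      (norm_coeff_expand_le _ zero_le_one hθ) (r := 1) le_rfl
      (by simpa using norm_coeff_pow_sub_expand_le hθ) m
    rw [pow_one] at h
    calc ‖a / p‖ * ‖coeff m (ℓ.subst (θ ^ p) - ℓ.subst (expand p (prime_ne_zero p) θ))‖
        ≤ p * (p : ℝ)⁻¹ := by
          refine mul_le_mul ?_ h (norm_nonneg _) (by positivity)
          rw [norm_div, Padic.norm_p, div_inv_eq_mul]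
          calc ‖a‖ * p ≤ 1 * p := by gcongr
            _ = p := one_mul _
      _ = 1 := mul_inv_cancel₀ (by exact_mod_cast hp.out.ne_zero)
  have A2 : ∀ m, ‖coeff m (C (1 / (p : ℚ_[p])) * (ℓ.subst (θ ^ p ^ 2) -
      ℓ.subst (expand (p ^ 2) (prime_sq_ne_zero p) θ)))‖ ≤ 1 := by
    intro m
    rw [norm_coeff_C_mul]
    have h := norm_coeff_subst_sub_subst_le ha hT hθp20 he20 (norm_coeff_pow_le_one hθ _)
      (norm_coeff_expand_le _ zero_le_one hθ) (r := 1) le_rfl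
      (by simpa using norm_coeff_pow_sq_sub_expand_le hθ) m
    rw [pow_one] at h
    calc ‖(1 : ℚ_[p]) / p‖ * ‖coeff m (ℓ.subst (θ ^ p ^ 2) -
          ℓ.subst (expand (p ^ 2) (prime_sq_ne_zero p) θ))‖ ≤ p * (p : ℝ)⁻¹ := by
          refine mul_le_mul ?_ h (norm_nonneg _) (by positivity)
          rw [norm_div, norm_one, Padic.norm_p, one_div, inv_inv]
      _ = 1 := mul_inv_cancel₀ (by exact_mod_cast hp.out.ne_zero)
  exact norm_coeff_sub_le (norm_coeff_add_le A0 A1) A2 n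

end FEiii

/-! ### The compositional inverse of an integral `θ = X + ⋯` is integral -/

section Inverse

/-- Right inverses under composition are unique: if `ι(θ) = X` and `θ(ψ) = X` then `ψ = ι`.
[folklore] -/
theorem eq_of_subst_eq_X {θ ψ ι : ℚ_[p]⟦X⟧} (hsθ : HasSubst θ) (hψ : HasSubst ψ)
    (hleft : ι.subst θ = X) (h : θ.subst ψ = X) : ψ = ι := by
  have e1 : PowerSeries.subst ψ (ι.subst θ) = ι.subst (θ.subst ψ) :=
    subst_comp_subst_apply hsθ hψ ι
  rw [hleft, h, X_subst, subst_X hψ] at e1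
  exact e1

/-- **The compositional inverse of `θ = X + ⋯ ∈ ℤ_p⟦X⟧` lies in `ℤ_p⟦X⟧`** (it is constructed over
`ℤ_p`, where `θ'(0) = 1` is a unit, and right inverses are unique). [folklore] -/
theorem norm_coeff_substInvOfIsUnit_le_one {θ : ℚ_[p]⟦X⟧} (hθ0 : constantCoeff θ = 0)
    (hθ1 : coeff 1 θ = 1) (hθ : ∀ n, ‖coeff n θ‖ ≤ 1) (h1 : IsUnit (coeff 1 θ)) (n : ℕ) :
    ‖coeff n (substInvOfIsUnit θ h1)‖ ≤ 1 := by
  set Θ := liftInt θ hθ with hΘ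
  have hcoeff : ∀ m, coeff m Θ = ⟨coeff m θ, hθ m⟩ := fun m ↦ by rw [hΘ, liftInt, coeff_mk]
  have hΘ0 : constantCoeff Θ = 0 := by
    rw [← coeff_zero_eq_constantCoeff_apply, hcoeff]
    refine Subtype.ext ?_
    change coeff 0 θ = 0
    rw [coeff_zero_eq_constantCoeff_apply, hθ0]
  have hΘ1 : coeff 1 Θ = 1 := by
    rw [hcoeff]
    exact Subtype.ext hθ1
  have hΘu : IsUnit (coeff 1 Θ) := by rw [hΘ1]; exact isUnit_one
  set Ψ := substInvOfIsUnit Θ hΘu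
  have hright : Θ.subst Ψ = X := subst_substInvOfIsUnit_right Θ hΘ0 hΘu
  -- map to `ℚ_p`: `θ(Ψ_ℚ) = X`
  have hψ : θ.subst (Ψ.map PadicInt.Coe.ringHom) = X := by
    have := congrArg (PowerSeries.map (PadicInt.Coe.ringHom (p := p))) hright
    rwa [map_subst_apply (HasSubst.substInvOfIsUnit Θ hΘu), map_liftInt, map_X] at this
  have hψs : HasSubst (Ψ.map (PadicInt.Coe.ringHom (p := p))) := by
    refine HasSubst.of_constantCoeff_zero' ?_
    rw [← coeff_zero_eq_constantCoeff_apply, coeff_map, coeff_zero_eq_constantCoeff_apply,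
      constantCoeff_substInvOfIsUnit, map_zero]
  rw [← eq_of_subst_eq_X (HasSubst.of_constantCoeff_zero' hθ0) hψs
    (subst_substInvOfIsUnit_left θ hθ0 h1) hψ, coeff_map]
  exact (coeff n Ψ).2

end Inverse



end Literature.RingTheory.FormalGroups
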